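import Literature.AlgebraicGeometry.Motives.MixedHodgeStructureIndecomposable
import HarnessLib

/-!
# The endomorphisms of an indecomposable mixed Hodge structure form a local ring

Fitting's lemma for an indecomposable object of finite length of an abelian category (here: an indecomposable
mixed Hodge structure on a finite-dimensional `ℚ`-space; Cattani–El Zein–Griffiths–Lê, *Hodge Theory*, Thm. 3.2.18,
p. 270; the tree's `IsIndecomposable.bijective_or_isNilpotent`) makes the non-invertible endomorphisms a two-sided
ideal: **they are nilpotent, closed under composition with arbitrary endomorphisms and under addition**. Hence
`End_MHS(H)` is a local ring: a (finite) sum of endomorphisms is an isomorphism only if some summand is — the key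
input of the Krull–Schmidt uniqueness theorem. Statements are phrased on underlying linear maps (no ring instance on
`Hom H H` is introduced). Namespace `MixedHodgeStructure`; everything proved, no named facts.

## References

* [CattaniElZeinGriffithsLe2014] E. Cattani et al. (eds.), Hodge Theory (2014), Thm. 3.2.18, p. 270.
-/

noncomputable section

namespace Literature.AlgebraicGeometry.Motives

namespace MixedHodgeStructure

universe u

variable {V : Type u} [AddCommGroup V] [Module ℚ V] [FiniteDimensional ℚ V]
variable {H : MixedHodgeStructure V}

open Module

/-! ### §1 Non-isomorphisms are closed under composition (any `H`) -/

/-- An endomorphism of a finite-dimensional MHS is bijective iff injective. [cite: CattaniElZeinGriffithsLe2014, Thm. 3.2.18] -/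
theorem Hom.bijective_iff_injective (f : Hom H H) : Function.Bijective f.toLinearMap ↔ Function.Injective f.toLinearMap :=
  ⟨fun h => h.1, fun h => ⟨h, LinearMap.injective_iff_surjective.1 h⟩⟩

/-- An endomorphism of a finite-dimensional MHS is bijective iff surjective. [cite: CattaniElZeinGriffithsLe2014, Thm. 3.2.18] -/
theorem Hom.bijective_iff_surjective (f : Hom H H) :
    Function.Bijective f.toLinearMap ↔ Function.Surjective f.toLinearMap :=
  ⟨fun h => h.2, fun h => ⟨LinearMap.injective_iff_surjective.2 h, h⟩⟩

/-- `g ∘ f` is not an isomorphism if `f` is not. [cite: CattaniElZeinGriffithsLe2014, Thm. 3.2.18] -/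
theorem Hom.not_bijective_comp_of_right (g f : Hom H H) (hf : ¬Function.Bijective f.toLinearMap) :
    ¬Function.Bijective (g.comp f).toLinearMap := fun h =>
  hf ((Hom.bijective_iff_injective f).2 (Function.Injective.of_comp (f := g.toLinearMap)
    (by rw [← LinearMap.coe_comp]; exact h.1)))

/-- `g ∘ f` is not an isomorphism if `g` is not. [cite: CattaniElZeinGriffithsLe2014, Thm. 3.2.18] -/
theorem Hom.not_bijective_comp_of_left (g f : Hom H H) (hg : ¬Function.Bijective g.toLinearMap) :
    ¬Function.Bijective (g.comp f).toLinearMap := fun h =>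
  hg ((Hom.bijective_iff_surjective g).2 (Function.Surjective.of_comp (g := f.toLinearMap)
    (by rw [← LinearMap.coe_comp]; exact h.2)))

/-! ### §2 Indecomposable `H`: non-isomorphisms are closed under addition -/

/-- **For indecomposable `H`, the sum of two non-isomorphisms is a non-isomorphism** (if `f + g = u` were invertible,
`g u⁻¹` would be nilpotent, so `f u⁻¹ = 1 - g u⁻¹` invertible, so `f` invertible).
[cite: CattaniElZeinGriffithsLe2014, Thm. 3.2.18 and p. 270] -/
theorem IsIndecomposable.not_bijective_add (h : H.IsIndecomposable) (f g : Hom H H)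
    (hf : ¬Function.Bijective f.toLinearMap) (hg : ¬Function.Bijective g.toLinearMap) :
    ¬Function.Bijective (f.add g).toLinearMap := by
  intro hu
  let v := (f.add g).inverse hu
  -- `g ∘ v` is not bijective, hence nilpotent
  have hgv : IsNilpotent (g.comp v).toLinearMap :=
    h.isNilpotent_of_not_bijective _ (Hom.not_bijective_comp_of_left g v hg)
  -- `f ∘ v = 1 - g ∘ v` is a unit
  have hsum : (f.comp v).toLinearMap = 1 - (g.comp v).toLinearMap := by
    rw [eq_sub_iff_add_eq, Hom.comp_toLinearMap, Hom.comp_toLinearMap, ← LinearMap.add_comp, ← Hom.add_toLinearMap,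
      ← Hom.comp_toLinearMap, Hom.comp_inverse]
    rfl
  have hfv : Function.Bijective (f.comp v).toLinearMap := by
    rw [← Module.End.isUnit_iff, hsum]
    exact hgv.isUnit_one_sub
  exact Hom.not_bijective_comp_of_left f v hf hfv

/-- **Local-ring dichotomy: if `f + g` is an isomorphism then `f` or `g` is.** [cite: CattaniElZeinGriffithsLe2014, Thm. 3.2.18 and p. 270] -/
theorem IsIndecomposable.bijective_or_bijective_of_bijective_add (h : H.IsIndecomposable) (f g : Hom H H)
    (hfg : Function.Bijective (f.add g).toLinearMap) :
    Function.Bijective f.toLinearMap ∨ Function.Bijective g.toLinearMap := by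
  by_contra hne
  rw [not_or] at hne
  exact h.not_bijective_add f g hne.1 hne.2 hfg

/-- The nilpotent (= non-invertible) endomorphisms of an indecomposable MHS are closed under addition.
[cite: CattaniElZeinGriffithsLe2014, Thm. 3.2.18 and p. 270] -/
theorem IsIndecomposable.isNilpotent_add (h : H.IsIndecomposable) (f g : Hom H H) (hf : IsNilpotent f.toLinearMap)
    (hg : IsNilpotent g.toLinearMap) : IsNilpotent (f.add g).toLinearMap := by
  haveI := h.nontrivial
  have hnb : ∀ k : Hom H H, IsNilpotent k.toLinearMap → ¬Function.Bijective k.toLinearMap := fun k hk hb => by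
    obtain ⟨n, hn⟩ := hk
    have hb' : Function.Bijective ⇑(k.toLinearMap ^ n) := by
      rw [← Module.End.isUnit_iff]; exact ((Module.End.isUnit_iff _).2 hb).pow n
    obtain ⟨x, hx⟩ := exists_ne (0 : V)
    exact hx (hb'.1 (by rw [hn, map_zero]; rfl))
  exact h.isNilpotent_of_not_bijective _ (h.not_bijective_add f g (hnb f hf) (hnb g hg))

/-- Nilpotent endomorphisms of an indecomposable MHS absorb composition: `g ∘ f` is nilpotent if `f` is.
[cite: CattaniElZeinGriffithsLe2014, Thm. 3.2.18 and p. 270] -/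
theorem IsIndecomposable.isNilpotent_comp_of_right (h : H.IsIndecomposable) (g f : Hom H H)
    (hf : ¬Function.Bijective f.toLinearMap) : IsNilpotent (g.comp f).toLinearMap :=
  h.isNilpotent_of_not_bijective _ (Hom.not_bijective_comp_of_right g f hf)

/-- … and `f ∘ g` is nilpotent if `f` is not bijective. [cite: CattaniElZeinGriffithsLe2014, Thm. 3.2.18 and p. 270] -/
theorem IsIndecomposable.isNilpotent_comp_of_left (h : H.IsIndecomposable) (f g : Hom H H)
    (hf : ¬Function.Bijective f.toLinearMap) : IsNilpotent (f.comp g).toLinearMap :=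
  h.isNilpotent_of_not_bijective _ (Hom.not_bijective_comp_of_left f g hf)

/-! ### §3 Finite sums -/

omit [FiniteDimensional ℚ V] in
/-- A finite sum of endomorphisms (of MHS) is the underlying map of an endomorphism of MHS.
[cite: CattaniElZeinGriffithsLe2014, Thm. 3.2.18] -/
theorem Hom.exists_toLinearMap_eq_sum {ι : Type*} (s : Finset ι) (f : ι → Hom H H) :
    ∃ F : Hom H H, F.toLinearMap = ∑ i ∈ s, (f i).toLinearMap := by
  classical
  induction s using Finset.induction_on with
  | empty => exact ⟨Hom.zero H H, by rw [Finset.sum_empty]; rfl⟩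
  | insert i s hi ih =>
    obtain ⟨F, hF⟩ := ih
    exact ⟨(f i).add F, by rw [Finset.sum_insert hi, Hom.add_toLinearMap, hF]⟩

/-- **If a finite sum of endomorphisms of an indecomposable MHS is an isomorphism, some summand is.**
[cite: CattaniElZeinGriffithsLe2014, Thm. 3.2.18 and p. 270] -/
theorem IsIndecomposable.exists_bijective_of_bijective_sum (h : H.IsIndecomposable) {ι : Type*} (s : Finset ι)
    (f : ι → Hom H H) (hs : Function.Bijective ⇑(∑ i ∈ s, (f i).toLinearMap)) :
    ∃ i ∈ s, Function.Bijective (f i).toLinearMap := by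
  classical
  induction s using Finset.induction_on with
  | empty =>
    haveI := h.nontrivial
    rw [Finset.sum_empty] at hs
    obtain ⟨x, hx⟩ := exists_ne (0 : V)
    exact absurd (hs.1 (show (0 : Module.End ℚ V) x = (0 : Module.End ℚ V) 0 by rw [map_zero]; rfl)) hx
  | insert i s hi ih =>
    obtain ⟨F, hF⟩ := Hom.exists_toLinearMap_eq_sum s f
    rw [Finset.sum_insert hi, ← hF, ← Hom.add_toLinearMap] at hs
    rcases h.bijective_or_bijective_of_bijective_add _ _ hs with h1 | h2
    · exact ⟨i, Finset.mem_insert_self i s, h1⟩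
    · rw [hF] at h2
      obtain ⟨j, hj, hj'⟩ := ih h2
      exact ⟨j, Finset.mem_insert_of_mem hj, hj'⟩

/-- In particular, if endomorphisms `f_i` of an indecomposable `H` sum to the identity, one of them is an
isomorphism (the form used in the Krull–Schmidt exchange argument). [cite: CattaniElZeinGriffithsLe2014, Thm. 3.2.18 and p. 270] -/
theorem IsIndecomposable.exists_bijective_of_sum_eq_id (h : H.IsIndecomposable) {ι : Type*} (s : Finset ι)
    (f : ι → Hom H H) (hs : ∑ i ∈ s, (f i).toLinearMap = LinearMap.id) : ∃ i ∈ s, Function.Bijective (f i).toLinearMap :=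
  h.exists_bijective_of_bijective_sum s f (by rw [hs]; exact Function.bijective_id)

end MixedHodgeStructure

end Literature.AlgebraicGeometry.Motives
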